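import Summits.ABC.ABC.Theses.IsogenyGlueCongruence
import Literature.NumberTheory.EllipticCurves.PastenSpectralDegreeIsogenyBoundProofs
import Literature.NumberTheory.EllipticCurves.LatticeMultiplierIndex
import Literature.NumberTheory.EllipticCurves.EichlerShimuraConstructionProofs
import Literature.NumberTheory.EllipticCurves.GlobalMinimalModelProofs

/-!
# `MazurKenkuBound` (stmt-ABC-15125) · Negative · load-bearing hypotheses

Negative-side knowledge for the crux `IsogenyGlueCongruence.MazurKenkuBound` (= the vendored fact
`PastenShimura2024_minimalDegree_le_163_mul` verbatim: `deg D' ≤ 163 · deg D` for a class-minimal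
datum `D` and a minimal datum `D'` of a GLOBALLY MINIMAL `W'` with the same newform; Mazur 1978,
Thm. 1 + Kenku 1982 + Néron functoriality in print, so no unconditional refutation is expected),
extracted from the standing disprover's work file `Cruxes/MazurKenkuBound/Disproof.lean`
(refuter-cdisprove-stmt-ABC-15125-0, cycle 1, 2026-08-16). Sorry-free; no theorem asserts a Theses
decl positively. Companion (independent): `StrongForm.lean` — hypothesis (ii) redundant,
divisibility form, exact open content. Both witnesses below are modulo ONE hypothesis
`SomeCurveParametrised`: some elliptic curve over `ℚ` carries a modular parametrisation datum
(= modularity with a Manin constant of a single curve; in the tree the route item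
`ModularDatumExists`, stmt-ABC-15126, at one curve).

* `sq_le_natCard_ker_isogenyMap` — index tool `k² ≤ [Λ_E : c Λ_f]` from a `k`-divisibility pattern
  (`PeriodPair.natCard_quotient_range_mulLeft`: `[Λ : kΛ] = k k̄ = k²`).
* `exists_datum_smul` — a datum with prescribed integral Manin constant on a rescaled model `C • V`
  (Néron-type lattice `u Λ_V`; uniformisation and degree are the tree's theorems
  `IsNeronLatticeOf.exists_uniformize_holds`, `exists_modularDegree_holds`); hence
  `exists_globallyMinimal_nonempty` (a GLOBALLY MINIMAL parametrised curve from any parametrised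
  curve, `hasGlobalMinimalModel_rat_holds`).
* `mazurKenkuBound_false_without_DPrimeMin_of` — hypothesis (iii) (minimality of `D'` among the
  data of `W'`) is LOAD-BEARING: without it the statement is FALSE (modulo H); witness: the datum
  with Manin constant `13 c` (`exists_datum_c_eq`), of degree `≥ 169 δ > 163 δ = 163 · deg D₀`
  (`D₀` the optimal datum, class-minimal, `exists_optimalDatum'`).
* `mazurKenkuBound_false_without_minimalModel_of` — the instance `[W'.IsGloballyMinimal]` is
  LOAD-BEARING: over arbitrary elliptic `W'` the statement is FALSE (modulo H); witness: the
  rescaled model `thirteenInv • E_f` (`u = 13⁻¹`, Néron-type lattice `13⁻¹ Λ_f ⊋ Λ_f`), whose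
  MINIMAL datum still has degree `≥ 169 δ`. Formal shadow of "the Manin constant `1/13` of a
  non-minimal model is not an integer": any proof of the crux must use the Néron integrality that
  `IsGloballyMinimal` buys (the `hInt` input of the tree's
  `PastenShimura2024_minimalDegree_le_163_mul_of_mazurKenku`) and the minimality of `D'` (the passage
  to a MINIMAL, hence cyclic, isogeny in Mazur–Kenku).

## References

* B. Mazur, *Rational isogenies of prime degree*, Invent. Math. 44 (1978), 129–162: Thm. 1.
* M. A. Kenku, *On the number of ℚ-isomorphism classes of elliptic curves in each ℚ-isogeny class*,
  J. Number Theory 15 (1982), 199–202.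
* H. Pasten, *Shimura curves and the abc conjecture*, J. Number Theory 254 (2024), 214–335: §3 p. 13.
* J. H. Silverman, *The Arithmetic of Elliptic Curves*, 2nd ed., GTM 106 (2009): III.1 Table 3.1,
  Thm. VI.4.1, VIII.8.3.
-/

-- `Summit.ABC.ABC` is the mandated summit-side namespace (CONVENTIONS §2); the duplicate is
-- deliberate.
set_option linter.dupNamespace false

noncomputable section

namespace Summit.ABC.ABC.Theorems.MazurKenkuBound.Negative

open Literature.NumberTheory.EllipticCurves.ModularForms
open Summit.ABC.ABC.Theses.IsogenyGlueCongruence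
open scoped MatrixGroups ModularForm
open CongruenceSubgroup

/-! ### The index tool: `k² ≤ [Λ_E : c Λ_f]` from `k`-divisibility of the Manin constant -/

/-- **Kernel lower bound.** Let `Dx` be a datum (`c Λ_f ⊆ Λ_E`, isogeny `z ↦ c z : ℂ/Λ_f → ℂ/Λ_E`)
and `L` a period pair, `β ∈ ℂ`, `k ≥ 1` such that `c β Λ_L ⊆ Λ_E` (so `λ ↦ β λ (mod Λ_f)` maps
`Λ_L` into `ker`) and `β λ ∈ Λ_f ⇒ λ ∈ k Λ_L` (its kernel lies in `k Λ_L`). Then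
`k² = [Λ_L : k Λ_L] ≤ #ker(z ↦ c z)` (the index `[Λ : kΛ] = k k̄ = k²` is the tree's
`PeriodPair.natCard_quotient_range_mulLeft`). [folklore] -/
theorem sq_le_natCard_ker_isogenyMap {W : WeierstrassCurve ℚ} {N : ℕ} [NeZero N]
    (Dx : ModularParametrizationData W N) (L : PeriodPair) {β : ℂ} {k : ℕ} (hk : k ≠ 0)
    (h_in : ∀ l ∈ L.lattice, (Dx.c : ℂ) * (β * l) ∈ Dx.L.lattice)
    (h_out : ∀ l ∈ L.lattice, β * l ∈ periodLattice Dx.f → ∃ l' ∈ L.lattice, l = (k : ℂ) * l')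
    [Finite Dx.isogenyMap.ker] : k ^ 2 ≤ Nat.card Dx.isogenyMap.ker := by
  have hk0 : (k : ℂ) ≠ 0 := Nat.cast_ne_zero.mpr hk
  -- `ψ : Λ_L → ℂ/Λ_f`, `λ ↦ β λ`
  set ψ : L.lattice →+ ℂ ⧸ periodLattice Dx.f :=
    (QuotientAddGroup.mk' (periodLattice Dx.f)).comp
      ((AddMonoidHom.mulLeft β).comp L.lattice.subtype.toAddMonoidHom) with hψ
  have hψ_apply : ∀ l : L.lattice, ψ l = ((β * (l : ℂ) : ℂ) : ℂ ⧸ periodLattice Dx.f) :=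
    fun _ ↦ rfl
  -- its range lies in the kernel of the isogeny
  have hrange : ψ.range ≤ Dx.isogenyMap.ker := by
    rintro _ ⟨l, rfl⟩
    rw [AddMonoidHom.mem_ker, hψ_apply, Dx.isogenyMap_mk, QuotientAddGroup.eq_zero_iff]
    exact h_in l l.2
  -- its kernel lies in `k Λ_L`
  have hα : ∀ l ∈ L.lattice, (k : ℂ) * l ∈ L.lattice := fun l hl ↦ by
    simpa [nsmul_eq_mul] using nsmul_mem hl k
  set Nk : Submodule ℤ L.lattice := LinearMap.range ((LinearMap.mulLeft ℤ (k : ℂ)).restrict hα)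
    with hNk
  have hker : ψ.ker ≤ Nk.toAddSubgroup := by
    intro l hl
    rw [AddMonoidHom.mem_ker, hψ_apply, QuotientAddGroup.eq_zero_iff] at hl
    obtain ⟨l', hl', hll'⟩ := h_out l l.2 hl
    rw [Submodule.mem_toAddSubgroup, hNk, PeriodPair.mem_range_restrict_mulLeft_iff]
    exact ⟨l', hl', hll'⟩
  -- `[Λ_L : k Λ_L] = k²`
  have hidx : Nk.toAddSubgroup.index = k ^ 2 := by
    have h := L.natCard_quotient_range_mulLeft hα hk0
    rw [map_natCast] at h
    have h' : ((Nat.card (L.lattice ⧸ Nk) : ℕ) : ℂ) = ((k ^ 2 : ℕ) : ℂ) := by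
      rw [hNk, h]; push_cast; ring
    exact_mod_cast h'
  -- count
  have hfinR : Finite ψ.range :=
    Finite.of_injective _ (AddSubgroup.inclusion_injective hrange)
  have hpos : 0 < Nat.card ψ.range := Nat.card_pos
  have hdvd : k ^ 2 ∣ Nat.card ψ.range := by
    rw [← AddSubgroup.index_ker ψ, ← hidx]
    exact AddSubgroup.index_dvd_of_le hker
  exact (Nat.le_of_dvd hpos hdvd).trans (AddSubgroup.card_le_of_le hrange)

/-! ### The one existence hypothesis; data on rescaled and on globally minimal models -/

/-- **H (existence side, not constructible in the tree today):** some elliptic curve over `ℚ`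
admits a modular parametrisation datum at some level — modularity with a Manin constant of ONE
curve (e.g. `X₀(11) → 11a1`, Eichler–Shimura); in the tree only the general named facts
`exists_isNewformOf` / `nonempty_modularParametrizationData` (BCDT 2001, Thm. A) are recorded. -/
def SomeCurveParametrised : Prop :=
  ∃ (N : ℕ) (_ : NeZero N) (W : WeierstrassCurve ℚ) (_ : W.IsElliptic),
    Nonempty (ModularParametrizationData W N)

/-- **A datum on a rescaled model.** Let `V/ℚ` be elliptic with newform `f` and Néron-type period
pair `L_V`, `C = (u, r, s, t)` an admissible change of variables and `k ≠ 0` an integer with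
`k Λ_f ⊆ u Λ_V`. Then `C • V` has the Néron-type pair `u L_V` (`IsNeronLatticeOf.smul`; Silverman
AEC III.1, Table 3.1: `ω ↦ u⁻¹ ω`) and a datum with newform `f` (`IsNewformOf.of_isIsogenous`) and
Manin constant `k`; the uniformisation and the degree are the tree's theorems
`IsNeronLatticeOf.exists_uniformize_holds`, `exists_modularDegree_holds`. [folklore] -/
theorem exists_datum_smul {V : WeierstrassCurve ℚ} [V.IsElliptic] {N : ℕ} [NeZero N]
    {f : CuspForm (Gamma0 N) 2} (hf : IsNewformOf V f) {LV : PeriodPair}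
    (hLV : IsNeronLatticeOf (V.baseChange ℂ) LV) (C : WeierstrassCurve.VariableChange ℚ)
    {k : ℤ} (hk0 : k ≠ 0)
    (hk : ∀ z ∈ periodLattice f, (((C.u : ℚ) : ℂ))⁻¹ * ((k : ℂ) * z) ∈ LV.lattice) :
    ∃ L' : PeriodPair, IsNeronLatticeOf ((C • V).baseChange ℂ) L' ∧
      (∀ x : ℂ, x ∈ L'.lattice ↔ (((C.u : ℚ) : ℂ))⁻¹ * x ∈ LV.lattice) ∧
      ∃ D' : ModularParametrizationData (C • V) N, D'.f = f ∧ D'.c = k := by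
  have hf0 : f ≠ 0 := hf.1.ne_zero
  -- the Néron-type period pair `u L_V` of the rescaled model
  set Cc : WeierstrassCurve.VariableChange ℂ := C.map (algebraMap ℚ ℂ) with hCc
  have hmap : (C • V).baseChange ℂ = Cc • V.baseChange ℂ := by
    simp only [hCc, WeierstrassCurve.baseChange, WeierstrassCurve.map_variableChange]
  set L' : PeriodPair := LV.mulLeft ((Cc.u : ℂˣ) : ℂ) Cc.u.ne_zero with hL'def
  have hL' : IsNeronLatticeOf ((C • V).baseChange ℂ) L' := by
    rw [hmap]; exact hLV.smul Cc
  have hu : ((Cc.u : ℂˣ) : ℂ) = ((C.u : ℚ) : ℂ) := by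
    simp [hCc, WeierstrassCurve.VariableChange.map]
  have hmem' : ∀ x : ℂ, x ∈ L'.lattice ↔ (((C.u : ℚ) : ℂ))⁻¹ * x ∈ LV.lattice := fun x ↦ by
    rw [hL'def, PeriodPair.mem_mulLeft_lattice, hu]
  -- uniformisation of the rescaled model
  haveI : ((C • V).baseChange ℂ).IsElliptic := by
    rw [WeierstrassCurve.baseChange]; infer_instance
  obtain ⟨u, hker, hsurj, hspec⟩ := IsNeronLatticeOf.exists_uniformize_holds hL'
  have hc : ∀ z ∈ periodLattice f, (k : ℂ) * z ∈ L'.lattice := fun z hz ↦ (hmem' _).mpr (hk z hz)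
  -- the degree of `Γ₀(N)τ ↦ k · 2πi ∫ f (mod u Λ_V)`, transported to `(C • V)(ℂ)`
  obtain ⟨d, hd, hfin⟩ := exists_modularDegree_holds hf0 (L := L') (c := (k : ℂ))
    (Int.cast_ne_zero.mpr hk0) hc
  have hker' : L'.lattice.toAddSubgroup = u.ker :=
    SetLike.coe_injective (by rw [Submodule.coe_toAddSubgroup, hker])
  let e : ℂ ⧸ L'.lattice.toAddSubgroup ≃+ ((C • V).baseChange ℂ).toAffine.Point :=
    QuotientAddGroup.liftEquiv L'.lattice.toAddSubgroup hsurj hker'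
  have he : ∀ x : ℂ, e.toEquiv (x : ℂ ⧸ L'.lattice.toAddSubgroup) = u x := fun _ ↦ rfl
  have key := (finite_setOf_card_fiberOrbits_ne_iff e.toEquiv
    (fun τ : UpperHalfPlane ↦
      (((k : ℂ) * eichlerIntegral f τ : ℂ) : ℂ ⧸ L'.lattice.toAddSubgroup)) d).mpr hfin
  simp only [he] at key
  refine ⟨L', hL', hmem', ?_⟩
  exact ⟨{ f := f
           isNewformOf := hf.of_isIsogenous (WeierstrassCurve.isIsogenous_of_smul V C)
           L := L'
           isNeronLattice := hL'
           uniformize := u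
           ker_uniformize := hker
           uniformize_surjective := hsurj
           uniformize_spec := hspec
           c := k
           smul_periodLattice_le := hc
           deg := d
           deg_pos := hd
           deg_spec := key }, rfl, rfl⟩

/-- **A globally minimal parametrised curve from any parametrised curve.** The global minimal
model `C • W` of `W` (`hasGlobalMinimalModel_rat_holds`, Silverman AEC VIII.8.3) carries a datum
with the same newform and Manin constant `num(u) · c` (`exists_datum_smul`: `c Λ_f ⊆ Λ_E` gives
`num(u) c Λ_f = den(u) · u c Λ_f ⊆ u Λ_E`). [folklore] -/
theorem exists_globallyMinimal_nonempty {W : WeierstrassCurve ℚ} [W.IsElliptic] {N : ℕ}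
    [NeZero N] (D : ModularParametrizationData W N) :
    ∃ (W₀ : WeierstrassCurve ℚ) (_ : W₀.IsElliptic) (_ : W₀.IsGloballyMinimal),
      Nonempty (ModularParametrizationData W₀ N) := by
  obtain ⟨C, hC⟩ := WeierstrassCurve.hasGlobalMinimalModel_rat_holds W
  have hq0 : (C.u : ℚ) ≠ 0 := C.u.ne_zero
  have hqc : ((C.u : ℚ) : ℂ) ≠ 0 := by exact_mod_cast hq0
  have hk0 : (C.u : ℚ).num * D.c ≠ 0 :=
    mul_ne_zero (Rat.num_ne_zero.mpr hq0) D.maninConstant_ne_zero_holds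
  have hnum : (((C.u : ℚ).num : ℤ) : ℂ) = ((C.u : ℚ).den : ℂ) * ((C.u : ℚ) : ℂ) := by
    have h' : (((C.u : ℚ).den : ℚ) : ℂ) * (((C.u : ℚ) : ℚ) : ℂ) = (((C.u : ℚ).num : ℚ) : ℂ) := by
      rw [← Rat.cast_mul, Rat.den_mul_eq_num]
    simpa using h'.symm
  have hk : ∀ z ∈ periodLattice D.f,
      (((C.u : ℚ) : ℂ))⁻¹ * ((((C.u : ℚ).num * D.c : ℤ) : ℂ) * z) ∈ D.L.lattice := fun z hz ↦ by
    have h1 := nsmul_mem (D.smul_periodLattice_le z hz) (C.u : ℚ).den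
    have h2 : (((C.u : ℚ) : ℂ))⁻¹ * ((((C.u : ℚ).num * D.c : ℤ) : ℂ) * z) =
        (C.u : ℚ).den • ((D.c : ℂ) * z) := by
      rw [nsmul_eq_mul]; push_cast; rw [hnum]; field_simp
    rwa [h2]
  obtain ⟨L', -, -, D', -, -⟩ := exists_datum_smul D.isNewformOf D.isNeronLattice C hk0 hk
  exact ⟨C • W, inferInstance, hC, ⟨D'⟩⟩

/-! ### (a.iii) Hypothesis (iii) `hmin'` (minimality of `D'` among the data of `W'`) is load-bearing -/

/-- `MazurKenkuBound` with hypothesis (iii) — "`D'` has minimal degree among the data of `W'`" —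
DROPPED. FALSE as soon as one elliptic curve over `ℚ` carries a datum
(`mazurKenkuBound_false_without_DPrimeMin_of`). -/
def MazurKenkuBoundWithoutDPrimeMin : Prop :=
  ∀ (N : ℕ) [NeZero N] (W W' : WeierstrassCurve ℚ) [W.IsElliptic] [W'.IsElliptic]
    [W'.IsGloballyMinimal] (D : ModularParametrizationData W N)
    (D' : ModularParametrizationData W' N), D'.f = D.f →
    (∀ (W'' : WeierstrassCurve ℚ) [W''.IsElliptic] (D'' : ModularParametrizationData W'' N),
      D''.f = D.f → D.modularDegree ≤ D''.modularDegree) →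
    D'.modularDegree ≤ 163 * D.modularDegree

/-- **`hmin'` is load-bearing (modulo H = `SomeCurveParametrised`).** Witness: let `D` be a
datum of a globally minimal `W` (from H via `exists_globallyMinimal_nonempty`), `f` its newform, `δ` the degree of the Eichler–Shimura map
`Y₀(N) → ℂ/Λ_f`, `D₀` the optimal datum of the strong Weil curve `W₀` (`exists_optimalDatum'`,
`deg D₀ = δ`, minimal in the class), and `D₁₃` the datum of `W` with Manin constant `13 c`
(`exists_datum_c_eq`). Then `deg D₁₃ = [Λ_E : 13 c Λ_f] · δ ≥ 13² δ = 169 δ > 163 δ = 163 · deg D₀`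
(`sq_le_natCard_ker_isogenyMap` with `β = (13c)⁻¹`), so the triple `(D₀, W, D₁₃)` violates the
statement without `hmin'`. Any proof of the crux must use the minimality of `D'`. [folklore] -/
theorem mazurKenkuBound_false_without_DPrimeMin_of (h : SomeCurveParametrised) :
    ¬ MazurKenkuBoundWithoutDPrimeMin := by
  intro hMK
  obtain ⟨N, hN, V, hV, ⟨DV⟩⟩ := h
  obtain ⟨W, hW, hWmin, ⟨D⟩⟩ := exists_globallyMinimal_nonempty DV
  have hf0 : D.f ≠ 0 := D.isNewformOf.1.ne_zero
  have hc0 := D.cast_c_ne_zero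
  haveI := discreteTopology_periodLattice_of_mul_mem D.f hc0 D.smul_periodLattice_le
  obtain ⟨δ, hδ, hfinδ⟩ := exists_degree_eichlerShimuraMap' (N := N) hf0
  -- the optimal datum `D₀`: minimal in the class, of degree `δ`
  obtain ⟨W₀, hW₀, D₀, hf₀, h₀⟩ := D.exists_optimalDatum'
  haveI := hW₀
  have hker₀ : D₀.isogenyMap.ker = ⊥ := D₀.isogenyMap_ker_eq_bot_iff.mpr h₀
  have hmin₀ : ∀ (W'' : WeierstrassCurve ℚ) [W''.IsElliptic]
      (D'' : ModularParametrizationData W'' N), D''.f = D₀.f →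
        D₀.modularDegree ≤ D''.modularDegree := fun W'' _ D'' hD'' ↦
    D₀.modularDegree_le_of_isogenyMap_ker_eq_bot hker₀ D'' hD''
  have hdeg₀ : D₀.modularDegree = δ := by
    obtain ⟨-, h⟩ := D₀.modularDegree_eq_card_ker_mul_of_eichlerShimuraMap hf₀ hδ hfinδ
    rw [h, hker₀, AddSubgroup.card_bot, one_mul]
  -- the datum `D₁₃` of `W` with Manin constant `13 c`
  have hk : ∀ z ∈ periodLattice D.f, (((13 : ℤ) * D.c : ℤ) : ℂ) * z ∈ D.L.lattice := fun z hz ↦ by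
    have h1 := nsmul_mem (D.smul_periodLattice_le z hz) 13
    have h2 : (((13 : ℤ) * D.c : ℤ) : ℂ) * z = 13 • ((D.c : ℂ) * z) := by
      rw [nsmul_eq_mul]; push_cast; ring
    rwa [h2]
  have hk0 : ((13 : ℤ) * D.c : ℤ) ≠ 0 := mul_ne_zero (by norm_num) D.maninConstant_ne_zero_holds
  obtain ⟨Dk, hfk, hLk, -, hck⟩ := D.exists_datum_c_eq hk0 hk
  -- the mutilated statement applied to `(D₀, W, D₁₃)`
  have h163 : Dk.modularDegree ≤ 163 * D₀.modularDegree :=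
    hMK N W₀ W D₀ Dk (hfk.trans hf₀.symm) hmin₀
  obtain ⟨hfinK, hdegK⟩ := Dk.modularDegree_eq_card_ker_mul_of_eichlerShimuraMap hfk hδ hfinδ
  haveI := hfinK
  have h_in : ∀ l ∈ Dk.L.lattice, (Dk.c : ℂ) * (((Dk.c : ℂ))⁻¹ * l) ∈ Dk.L.lattice :=
    fun l hl ↦ by rwa [mul_inv_cancel_left₀ Dk.cast_c_ne_zero]
  have h_out : ∀ l ∈ Dk.L.lattice, ((Dk.c : ℂ))⁻¹ * l ∈ periodLattice Dk.f →
      ∃ l' ∈ Dk.L.lattice, l = ((13 : ℕ) : ℂ) * l' := fun l hl hmem ↦ by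
    have h1 : (D.c : ℂ) * (((Dk.c : ℂ))⁻¹ * l) ∈ D.L.lattice :=
      D.smul_periodLattice_le _ (hfk ▸ hmem)
    have h2 : (D.c : ℂ) * (((Dk.c : ℂ))⁻¹ * l) = ((13 : ℂ))⁻¹ * l := by
      rw [hck]; push_cast; field_simp
    refine ⟨((13 : ℂ))⁻¹ * l, ?_, ?_⟩
    · rw [hLk, ← h2]; exact h1
    · push_cast; rw [mul_inv_cancel_left₀ (by norm_num : (13 : ℂ) ≠ 0)]
  have hge : 13 ^ 2 ≤ Nat.card Dk.isogenyMap.ker :=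
    sq_le_natCard_ker_isogenyMap Dk Dk.L (by norm_num) h_in h_out
  -- `169 δ ≤ deg D₁₃ ≤ 163 δ` with `δ ≥ 1`
  have hcontra : 13 ^ 2 * δ ≤ 163 * δ :=
    calc 13 ^ 2 * δ ≤ Nat.card Dk.isogenyMap.ker * δ := Nat.mul_le_mul_right δ hge
      _ = Dk.modularDegree := hdegK.symm
      _ ≤ 163 * D₀.modularDegree := h163
      _ = 163 * δ := by rw [hdeg₀]
  have := Nat.le_of_mul_le_mul_right hcontra hδ
  omega

/-! ### (a.i) The instance hypothesis `[W'.IsGloballyMinimal]` is load-bearing -/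

/-- `MazurKenkuBound` with the instance hypothesis `[W'.IsGloballyMinimal]` DROPPED (everything
else, including both minimality hypotheses, kept). FALSE as soon as one elliptic curve over `ℚ`
carries a datum (`mazurKenkuBound_false_without_minimalModel_of`). -/
def MazurKenkuBoundWithoutMinimalModel : Prop :=
  ∀ (N : ℕ) [NeZero N] (W W' : WeierstrassCurve ℚ) [W.IsElliptic] [W'.IsElliptic]
    (D : ModularParametrizationData W N) (D' : ModularParametrizationData W' N), D'.f = D.f →
    (∀ (W'' : WeierstrassCurve ℚ) [W''.IsElliptic] (D'' : ModularParametrizationData W'' N),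
      D''.f = D.f → D.modularDegree ≤ D''.modularDegree) →
    (∀ D'' : ModularParametrizationData W' N, D'.modularDegree ≤ D''.modularDegree) →
    D'.modularDegree ≤ 163 * D.modularDegree

/-- The rescaling `(x, y) ↦ (13² x, 13³ y)` as an admissible change of variables `u = 13⁻¹`:
`aᵢ ↦ 13ⁱ aᵢ`, `ω ↦ 13⁻¹ ω`, Néron-type lattice `Λ ↦ 13⁻¹ Λ` (Silverman AEC III.1, Table 3.1). [folklore] -/
def thirteenInv : WeierstrassCurve.VariableChange ℚ :=
  ⟨Units.mk0 (13 : ℚ)⁻¹ (by norm_num), 0, 0, 0⟩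

/-- **`[W'.IsGloballyMinimal]` is load-bearing (modulo H = `SomeCurveParametrised`).** Witness:
from a datum `D` (newform `f`, Eichler–Shimura degree `δ`) take the optimal datum `D₀` (`deg = δ`,
minimal in the class) and the rescaled model `W' = 13⁻¹ • E_f` with its Néron-type lattice
`13⁻¹ Λ_f` (`exists_datum_smul` on `E_f = ℂ/Λ_f`, `exists_latticeEq_model`, with `thirteenInv` and Manin constant `1`). A datum `D₁` of `W'` of MINIMAL degree exists
(`exists_minimal_datum`), and still `deg D₁ = [13⁻¹Λ_f : c₁ Λ_f] · δ ≥ 13² δ`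
(`sq_le_natCard_ker_isogenyMap` with `β = (13 c₁)⁻¹`: `λ/(13c₁)`, `λ ∈ Λ_f`, are `169` kernel
classes), so `(D₀, W', D₁)` satisfies every remaining hypothesis and `169 δ ≤ 163 δ` fails. In words:
for a non-minimal model the Manin "constant" of the cheapest parametrisation is `1/13 ∉ ℤ`, the
structure only admits integral constants, and the cheapest ADMISSIBLE datum is `[13] ∘ (that map)`,
of degree `169 ×` the optimal one. [folklore] -/
theorem mazurKenkuBound_false_without_minimalModel_of (h : SomeCurveParametrised) :
    ¬ MazurKenkuBoundWithoutMinimalModel := by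
  intro hMK
  obtain ⟨N, hN, W, hW, ⟨D⟩⟩ := h
  have hf0 : D.f ≠ 0 := D.isNewformOf.1.ne_zero
  have hc0 := D.cast_c_ne_zero
  haveI := discreteTopology_periodLattice_of_mul_mem D.f hc0 D.smul_periodLattice_le
  obtain ⟨δ, hδ, hfinδ⟩ := exists_degree_eichlerShimuraMap' (N := N) hf0
  -- the optimal datum `D₀`: minimal in the class, of degree `δ`
  obtain ⟨W₀, hW₀, D₀, hf₀, h₀⟩ := D.exists_optimalDatum'
  haveI := hW₀
  have hker₀ : D₀.isogenyMap.ker = ⊥ := D₀.isogenyMap_ker_eq_bot_iff.mpr h₀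
  have hmin₀ : ∀ (W'' : WeierstrassCurve ℚ) [W''.IsElliptic]
      (D'' : ModularParametrizationData W'' N), D''.f = D₀.f →
        D₀.modularDegree ≤ D''.modularDegree := fun W'' _ D'' hD'' ↦
    D₀.modularDegree_le_of_isogenyMap_ker_eq_bot hker₀ D'' hD''
  have hdeg₀ : D₀.modularDegree = δ := by
    obtain ⟨-, h⟩ := D₀.modularDegree_eq_card_ker_mul_of_eichlerShimuraMap hf₀ hδ hfinδ
    rw [h, hker₀, AddSubgroup.card_bot, one_mul]
  -- the rescaled model `W' = 13⁻¹ • E_f` and a minimal datum `D₁` of it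
  obtain ⟨W₁, hW₁, hfW₁, L₀, hL₀, hΛ⟩ := D.exists_latticeEq_model
  haveI := hW₁
  have hmem₀ : ∀ z : ℂ, z ∈ L₀.lattice ↔ z ∈ periodLattice D.f := fun z ↦ by
    rw [← SetLike.mem_coe, hΛ, SetLike.mem_coe]
  have hu13 : ((thirteenInv.u : ℚ) : ℂ) = (13 : ℂ)⁻¹ := by simp [thirteenInv]
  have h13 : (13 : ℂ) ≠ 0 := by norm_num
  have hk1 : ∀ z ∈ periodLattice D.f,
      (((thirteenInv.u : ℚ) : ℂ))⁻¹ * (((1 : ℤ) : ℂ) * z) ∈ L₀.lattice := fun z hz ↦ by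
    rw [hu13, inv_inv, Int.cast_one, one_mul]
    simpa [nsmul_eq_mul] using nsmul_mem ((hmem₀ z).mpr hz) 13
  obtain ⟨L', hL', hmemu, D', hf', -⟩ := exists_datum_smul hfW₁ hL₀ thirteenInv one_ne_zero hk1
  have hmem' : ∀ x : ℂ, x ∈ L'.lattice ↔ 13 * x ∈ L₀.lattice := fun x ↦ by
    rw [hmemu, hu13, inv_inv]
  obtain ⟨D₁, -, hD₁⟩ := exists_minimal_datum (W := thirteenInv • W₁) (N := N) ⟨D'⟩
  have hf₁ : D₁.f = D.f := (D₁.isNewformOf.unique D'.isNewformOf).trans hf'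
  have hΛ₁ : D₁.L.lattice = L'.lattice := IsNeronLatticeOf.lattice_eq D₁.isNeronLattice hL'
  -- the mutilated statement applied to `(D₀, W', D₁)`
  have h163 : D₁.modularDegree ≤ 163 * D₀.modularDegree :=
    hMK N W₀ (thirteenInv • W₁) D₀ D₁ (hf₁.trans hf₀.symm) hmin₀ hD₁
  obtain ⟨hfin₁, hdeg₁⟩ := D₁.modularDegree_eq_card_ker_mul_of_eichlerShimuraMap hf₁ hδ hfinδ
  haveI := hfin₁
  have hc₁ := D₁.cast_c_ne_zero
  have h_in : ∀ l ∈ L₀.lattice, (D₁.c : ℂ) * (((13 : ℂ) * D₁.c)⁻¹ * l) ∈ D₁.L.lattice :=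
    fun l hl ↦ by
    have h2 : (D₁.c : ℂ) * (((13 : ℂ) * D₁.c)⁻¹ * l) = ((13 : ℂ))⁻¹ * l := by field_simp
    rw [h2, hΛ₁, hmem', mul_inv_cancel_left₀ h13]
    exact hl
  have h_out : ∀ l ∈ L₀.lattice, ((13 : ℂ) * D₁.c)⁻¹ * l ∈ periodLattice D₁.f →
      ∃ l' ∈ L₀.lattice, l = ((13 : ℕ) : ℂ) * l' := fun l _ hmem ↦ by
    have h1 : ((13 : ℂ) * D₁.c)⁻¹ * l ∈ L₀.lattice := (hmem₀ _).mpr (hf₁ ▸ hmem)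
    refine ⟨(D₁.c : ℂ) * (((13 : ℂ) * D₁.c)⁻¹ * l), ?_, ?_⟩
    · simpa [zsmul_eq_mul] using zsmul_mem h1 D₁.c
    · push_cast; field_simp
  have hge : 13 ^ 2 ≤ Nat.card D₁.isogenyMap.ker :=
    sq_le_natCard_ker_isogenyMap D₁ L₀ (by norm_num) h_in h_out
  -- `169 δ ≤ deg D₁ ≤ 163 δ` with `δ ≥ 1`
  have hcontra : 13 ^ 2 * δ ≤ 163 * δ :=
    calc 13 ^ 2 * δ ≤ Nat.card D₁.isogenyMap.ker * δ := Nat.mul_le_mul_right δ hge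
      _ = D₁.modularDegree := hdeg₁.symm
      _ ≤ 163 * D₀.modularDegree := h163
      _ = 163 * δ := by rw [hdeg₀]
  have := Nat.le_of_mul_le_mul_right hcontra hδ
  omega

end Summit.ABC.ABC.Theorems.MazurKenkuBound.Negative

end
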